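import Summits.HodgeConjecture.HodgeConjecture.Theorems.A3Liu413LevelForm
import HarnessLib

/-!
# (S)+(MAIN) of the `h413` class-sum, EXPLICIT-SYSTEM FORM: the Hodge–Riemann summand calculus and the unitarizability of the
# tower for a GIVEN translate-compatible family of Kähler classes `ω Δ` (instead of the named fact `BallQuotientKaehlerClassSystem`)

Fan A, binder `h413` ([Liu 2021, Prop. 4.13]), junction «Matsushima at the pin», row III-4′(b) / B3-25.  A-p10's
`A3Liu413LevelSummand.lean` §Summand + (S5) and the MAIN `isUnitarizable_ofModule'_tower` of `A3Liu413LevelForm.lean` (p605005) consume the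
named fact `hΩ : BallQuotientKaehlerClassSystem` ONLY through, for ONE `V`, the per-level classes `ω_{X_Δ} := hΩ.omega X_Δ`, their Kähler
property (K) `isKaehlerClass_omega_level` and the exact translate compatibility (Ω2) `pull_transMor_omega`.  This file RE-DERIVES the same
statements with that triple as EXPLICIT DATA / HYPOTHESES

  `(ω : ∀ Δ : Level V, bettiCohomology X_Δ 2)`, `(hK : ∀ Δ, IsKaehlerClass 2 X_Δ (ofRatClass _ 2 (ω Δ)))`,
  `(hΩ2 : ∀ γ ∈ U(V)(L₀), TransCond γ Δ₁ Δ₂ → (transMor …)^* (ω Δ₂) = ω Δ₁)`,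

so that the B3-25 Model-side gluing (A-p09 g2: `exists_towerKaehlerClassSystem`, from the Fubini–Study fact `L_FS`) feeds the class-sum WITHOUT the
literal fact (whose ∀-closure over all `p` and all uniformised schemes is not derivable from `L_FS`; A-p09 PREP 2026-08-28T05:27:17Z (1)):

* (S0) `hrForm_trPull_ofSystem` — the rational translates `t_γ^*` are isometries of the `ω`-normalised Hodge–Riemann forms (from `hK`, `hΩ2`);
* (S1)–(S3) `hrForm_apply_eq_of_rel_ofIsometry`, `hrForm_restrictLevel_apply_ofIsometry`, `hrForm_translate_apply_ofIsometry` — the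
  family-relation / restriction / translation bookkeeping, now from the ISOMETRY property (S0) alone (hypothesis `hS0`), so that they do not
  repeat the normalisation clause; (S4) symmetry / positivity are `BettiUniverse.hrFormOne_symm` / `hrFormOne_posDef` verbatim (not restated);
* (S5) `exists_hrFormFamily_ofSystem`; MAIN `isUnitarizable_ofModule'_tower_ofSystem hHD hI hU h₃ hA V hL ω hK hΩ2` — the generic `levelSum_*` /
  `exists_levelForm` of `A3Liu413LevelForm.lean` §1 and `exists_invariantForm_towerRep` are used unchanged.

Proofs are those of the originals with `hΩ.omega X_Δ ↦ ω Δ`, (Ω2) ↦ `hΩ2`, (K) ↦ `hK` (the anisotropy binder of the originals only fed (Ω2)/(K) and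
drops).  All face data are PER-THEOREM binders (no section hypotheses).  Theorems only, no definition, no named fact; HC_CM is proved only modulo
the 7 printed citations until rung 0 closes.
-/

noncomputable section

open scoped Matrix TensorProduct ComplexConjugate Pointwise
open Matrix Function Set
open NumberField CategoryTheory IsDedekindDomain
open Literature.AlgebraicGeometry.Motives
open Literature.AlgebraicGeometry.ShimuraVarieties
open Literature.AlgebraicGeometry.HodgeTheory
open Literature.NumberTheory.Automorphic
open Literature.NumberTheory.Automorphic.PicardCM
open Literature.NumberTheory.Transcendental (Arapura2012_Cor_15_4_6)
open Literature.GroupTheory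
open HodgeCM.Adelic HodgeCM.PerL34.AdelicUnitaryFactorisation HodgeCM.PerL34.Godement

namespace HodgeCM

open HodgeCM.Model.LevelTranslate HodgeCM.Model.TowerCarrier

namespace Model.TowerLevel

/-! ## (S0) isometry of the rational translates for an explicit Kähler class system -/

/-- **(S0) The rational translates are isometries of the `ω`-normalised Hodge–Riemann forms**: for `γ ∈ U(V)(L₀)` translating `Δ₁`
into `Δ₂`, `B_{Δ₁} (t_γ^* α) (t_γ^* β) = B_{Δ₂} α β` (`BettiUniverse.hrFormOne_pull` at `t_γ = transMor …`, since `t_γ^* (ω Δ₂) = ω Δ₁`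
— hypothesis `hΩ2` — and the classes are Kähler, hypothesis `hK`; the EXPLICIT-SYSTEM form of `hrForm_trPull`). [cite: VoisinHodgeI2002, §7.3.2 and §6.3.2 Thm. 6.32] -/
theorem hrForm_trPull_ofSystem
    (hHD : exists_isReal_hodgeModel) (hI : hodgePQ_independent_of_hodgeModel) (hU : BallQuotientUniformisedDatum)
    (h₃ : CMAbelianVarietyRealised) (hA : Arapura2012_Cor_15_4_6) {L : CMField} {ι₁ : L →+* ℂ} {V : HermSpace3 L ι₁}
    (ω : ∀ Δ : Level V, bettiCohomology (Var.scheme hU h₃ (.pms (pmsCode L ι₁ V Δ))) 2)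
    (B : ∀ Δ : Level V, Coh hHD hI hU h₃ Δ 1 →ₗ⋆[ℂ] Coh hHD hI hU h₃ Δ 1 →ₗ[ℂ] ℂ)
    (hB : ∀ (Δ : Level V) (α₁ β₁ α₂ β₂ : Coh hHD hI hU h₃ Δ 1),
    α₁ ∈ (BettiUniverse.hodge hHD (Var.isSmoothProjective hU h₃ (.pms (pmsCode L ι₁ V Δ))) 1).F 1 →
    β₁ ∈ (BettiUniverse.hodge hHD (Var.isSmoothProjective hU h₃ (.pms (pmsCode L ι₁ V Δ))) 1).F 1 →
    α₂ ∈ Literature.AlgebraicGeometry.Motives.HodgeStructure.complexConj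
      ((BettiUniverse.hodge hHD (Var.isSmoothProjective hU h₃ (.pms (pmsCode L ι₁ V Δ))) 1).F 1) →
    β₂ ∈ Literature.AlgebraicGeometry.Motives.HodgeStructure.complexConj
      ((BettiUniverse.hodge hHD (Var.isSmoothProjective hU h₃ (.pms (pmsCode L ι₁ V Δ))) 1).F 1) →
    B Δ (α₁ + α₂) (β₁ + β₂) =
      Complex.I * (BettiUniverse.trC (Var.isSmoothProjective hU h₃ (.pms (pmsCode L ι₁ V Δ))) 4
          (LinearMap.BilinMap.baseChange ℂ (BettiUniverse.cup (Var.scheme hU h₃ (.pms (pmsCode L ι₁ V Δ))) 2 2)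
            (LinearMap.BilinMap.baseChange ℂ (BettiUniverse.cup (Var.scheme hU h₃ (.pms (pmsCode L ι₁ V Δ))) 1 1) β₁
              (Literature.AlgebraicGeometry.Motives.HodgeStructure.conj α₁))
            ((1 : ℂ) ⊗ₜ[ℚ] ω Δ)) /
        BettiUniverse.trC (Var.isSmoothProjective hU h₃ (.pms (pmsCode L ι₁ V Δ))) 4
          (LinearMap.BilinMap.baseChange ℂ (BettiUniverse.cup (Var.scheme hU h₃ (.pms (pmsCode L ι₁ V Δ))) 2 2)
            ((1 : ℂ) ⊗ₜ[ℚ] ω Δ)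
            ((1 : ℂ) ⊗ₜ[ℚ] ω Δ))) -
      Complex.I * (BettiUniverse.trC (Var.isSmoothProjective hU h₃ (.pms (pmsCode L ι₁ V Δ))) 4
          (LinearMap.BilinMap.baseChange ℂ (BettiUniverse.cup (Var.scheme hU h₃ (.pms (pmsCode L ι₁ V Δ))) 2 2)
            (LinearMap.BilinMap.baseChange ℂ (BettiUniverse.cup (Var.scheme hU h₃ (.pms (pmsCode L ι₁ V Δ))) 1 1) β₂
              (Literature.AlgebraicGeometry.Motives.HodgeStructure.conj α₂))
            ((1 : ℂ) ⊗ₜ[ℚ] ω Δ)) /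
        BettiUniverse.trC (Var.isSmoothProjective hU h₃ (.pms (pmsCode L ι₁ V Δ))) 4
          (LinearMap.BilinMap.baseChange ℂ (BettiUniverse.cup (Var.scheme hU h₃ (.pms (pmsCode L ι₁ V Δ))) 2 2)
            ((1 : ℂ) ⊗ₜ[ℚ] ω Δ)
            ((1 : ℂ) ⊗ₜ[ℚ] ω Δ))))
    (hK : ∀ Δ : Level V, IsKaehlerClass 2 (Var.scheme hU h₃ (.pms (pmsCode L ι₁ V Δ)))
      (ofRatClass (ComplexPoints (Var.scheme hU h₃ (.pms (pmsCode L ι₁ V Δ)))) 2 (ω Δ)))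
    (hΩ2 : ∀ {γ : GL (Fin 3) L} (hγ : γ ∈ Urat V) {Δ₁ Δ₂ : Level V} (ht : TransCond γ Δ₁ Δ₂),
      BettiUniverse.pull (transMor hU h₃ hHD hA hγ Δ₁ Δ₂ ht) 2 (ω Δ₂) = ω Δ₁)
    (γ : ↥(Urat V)) {Δ₁ Δ₂ : Level V}
    (ht : TransCond (γ : GL (Fin 3) L) Δ₁ Δ₂) (α β : Coh hHD hI hU h₃ Δ₂ 1) :
    B Δ₁ (trPull hHD hI hU h₃ hA γ Δ₁ Δ₂ ht 1 α) (trPull hHD hI hU h₃ hA γ Δ₁ Δ₂ ht 1 β) = B Δ₂ α β := by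
  have e := hΩ2 γ.2 ht
  have hω := hK Δ₂
  have hω' : IsKaehlerClass 2 (Var.scheme hU h₃ (.pms (pmsCode L ι₁ V Δ₁)))
      (ofRatClass (ComplexPoints (Var.scheme hU h₃ (.pms (pmsCode L ι₁ V Δ₁)))) 2
        (BettiUniverse.pull (transMor hU h₃ hHD hA γ.2 Δ₁ Δ₂ ht) 2 (ω Δ₂))) := by
    rw [e]; exact hK Δ₁
  have hB' := hB Δ₁
  rw [← e] at hB'
  exact BettiUniverse.hrFormOne_pull hHD hI (Var.isSmoothProjective hU h₃ (.pms (pmsCode L ι₁ V Δ₂)))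
    (Var.isSmoothProjective hU h₃ (.pms (pmsCode L ι₁ V Δ₁))) (transMor hU h₃ hHD hA γ.2 Δ₁ Δ₂ ht)
    (ω Δ₂) hω hω' (hB Δ₂) hB' α β

/-! ## (S1)–(S3) bookkeeping along the family relation, restriction and translation, from the isometry property alone -/

/-- **(S1) Along the family relation the summands agree**: for `c, c' ∈ towerLevel Γ` and `h' ∈ (γ)_f h K` (`Rel Γ γ h h'`),
`B_{Γ_h} (c h) (c' h) = B_{Γ_{h'}} (c h') (c' h')` (`c h = t_γ^* (c h')`, `apply_eq_trPull`, and the isometry hypothesis `hS0` = (S0)).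
[cite: VoisinHodgeI2002, §7.3.2] -/
theorem hrForm_apply_eq_of_rel_ofIsometry
    (hHD : exists_isReal_hodgeModel) (hI : hodgePQ_independent_of_hodgeModel) (hU : BallQuotientUniformisedDatum)
    (h₃ : CMAbelianVarietyRealised) (hA : Arapura2012_Cor_15_4_6) {L : CMField} {ι₁ : L →+* ℂ} {V : HermSpace3 L ι₁}
    (B : ∀ Δ : Level V, Coh hHD hI hU h₃ Δ 1 →ₗ⋆[ℂ] Coh hHD hI hU h₃ Δ 1 →ₗ[ℂ] ℂ)
    (hS0 : ∀ (γ : ↥(Urat V)) {Δ₁ Δ₂ : Level V} (ht : TransCond (γ : GL (Fin 3) L) Δ₁ Δ₂) (α β : Coh hHD hI hU h₃ Δ₂ 1),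
      B Δ₁ (trPull hHD hI hU h₃ hA γ Δ₁ Δ₂ ht 1 α) (trPull hHD hI hU h₃ hA γ Δ₁ Δ₂ ht 1 β) = B Δ₂ α β)
    {Γ : Level V} (hΓ : Γ.BelowConjThree)
    (c c' : towerLevel hHD hI hU h₃ hA Γ hΓ) {γ : ↥(Urat V)} {x x' : V.adelicFin} (r : Rel Γ γ x x') :
    B (Γ.conj x hΓ) ((c : Π h, W hHD hI hU h₃ Γ hΓ h) x) ((c' : Π h, W hHD hI hU h₃ Γ hΓ h) x) =
      B (Γ.conj x' hΓ) ((c : Π h, W hHD hI hU h₃ Γ hΓ h) x') ((c' : Π h, W hHD hI hU h₃ Γ hΓ h) x') := by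
  rw [apply_eq_trPull hHD hI hU h₃ hA c r (transCond_of_rel hΓ r), apply_eq_trPull hHD hI hU h₃ hA c' r (transCond_of_rel hΓ r)]
  exact hS0 γ (transCond_of_rel hΓ r) _ _

/-- **(S2) `restrictLevel` does not change the summands**: for `Γ' ≤ Γ`, `B_{Γ'_h} ((res c) h) ((res c') h) = B_{Γ_h} (c h) (c' h)`
(`restrictLevel_apply` = componentwise `t_1^*`, and the isometry hypothesis `hS0` at `γ = 1`). [cite: VoisinHodgeI2002, §7.3.2] -/
theorem hrForm_restrictLevel_apply_ofIsometry
    (hHD : exists_isReal_hodgeModel) (hI : hodgePQ_independent_of_hodgeModel) (hU : BallQuotientUniformisedDatum)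
    (h₃ : CMAbelianVarietyRealised) (hA : Arapura2012_Cor_15_4_6) {L : CMField} {ι₁ : L →+* ℂ} {V : HermSpace3 L ι₁}
    (B : ∀ Δ : Level V, Coh hHD hI hU h₃ Δ 1 →ₗ⋆[ℂ] Coh hHD hI hU h₃ Δ 1 →ₗ[ℂ] ℂ)
    (hS0 : ∀ (γ : ↥(Urat V)) {Δ₁ Δ₂ : Level V} (ht : TransCond (γ : GL (Fin 3) L) Δ₁ Δ₂) (α β : Coh hHD hI hU h₃ Δ₂ 1),
      B Δ₁ (trPull hHD hI hU h₃ hA γ Δ₁ Δ₂ ht 1 α) (trPull hHD hI hU h₃ hA γ Δ₁ Δ₂ ht 1 β) = B Δ₂ α β)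
    {Γ Γ' : Level V} (hle : Γ' ≤ Γ) (hΓ : Γ.BelowConjThree)
    (hΓ' : Γ'.BelowConjThree) (c c' : towerLevel hHD hI hU h₃ hA Γ hΓ) (x : V.adelicFin) :
    B (Γ'.conj x hΓ') ((restrictLevel hHD hI hU h₃ hA hle hΓ hΓ' c : Π h, W hHD hI hU h₃ Γ' hΓ' h) x)
        ((restrictLevel hHD hI hU h₃ hA hle hΓ hΓ' c' : Π h, W hHD hI hU h₃ Γ' hΓ' h) x) =
      B (Γ.conj x hΓ) ((c : Π h, W hHD hI hU h₃ Γ hΓ h) x) ((c' : Π h, W hHD hI hU h₃ Γ hΓ h) x) := by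
  rw [restrictLevel_apply, restrictLevel_apply]
  exact hS0 1 (transCond_conj_of_le hle hΓ hΓ' x) _ _

/-- **(S3) The summands of `translate g c` at `h` are those of `c` at `h * g`**:
`B_{(Γ^g)_h} ((g • c) h) ((g • c') h) = B_{Γ_{hg}} (c (h g)) (c' (h g))` (`translate_apply` = componentwise `t_1^*`, and the isometry
hypothesis `hS0` at `γ = 1`). [cite: VoisinHodgeI2002, §7.3.2] -/
theorem hrForm_translate_apply_ofIsometry
    (hHD : exists_isReal_hodgeModel) (hI : hodgePQ_independent_of_hodgeModel) (hU : BallQuotientUniformisedDatum)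
    (h₃ : CMAbelianVarietyRealised) (hA : Arapura2012_Cor_15_4_6) {L : CMField} {ι₁ : L →+* ℂ} {V : HermSpace3 L ι₁}
    (B : ∀ Δ : Level V, Coh hHD hI hU h₃ Δ 1 →ₗ⋆[ℂ] Coh hHD hI hU h₃ Δ 1 →ₗ[ℂ] ℂ)
    (hS0 : ∀ (γ : ↥(Urat V)) {Δ₁ Δ₂ : Level V} (ht : TransCond (γ : GL (Fin 3) L) Δ₁ Δ₂) (α β : Coh hHD hI hU h₃ Δ₂ 1),
      B Δ₁ (trPull hHD hI hU h₃ hA γ Δ₁ Δ₂ ht 1 α) (trPull hHD hI hU h₃ hA γ Δ₁ Δ₂ ht 1 β) = B Δ₂ α β)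
    {Γ : Level V} (hΓ : Γ.BelowConjThree) (g : V.adelicFin)
    (c c' : towerLevel hHD hI hU h₃ hA Γ hΓ) (x : V.adelicFin) :
    B ((Γ.conj g hΓ).conj x (hΓ.conj g))
        ((translate hHD hI hU h₃ hA hΓ g c : Π h, W hHD hI hU h₃ (Γ.conj g hΓ) (hΓ.conj g) h) x)
        ((translate hHD hI hU h₃ hA hΓ g c' : Π h, W hHD hI hU h₃ (Γ.conj g hΓ) (hΓ.conj g) h) x) =
      B (Γ.conj (x * g) hΓ) ((c : Π h, W hHD hI hU h₃ Γ hΓ h) (x * g)) ((c' : Π h, W hHD hI hU h₃ Γ hΓ h) (x * g)) := by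
  rw [translate_apply, translate_apply]
  exact hS0 1 (transCond_conj_conj hΓ g x) _ _

/-! ## (S5) existence of the `ω`-normalised family -/

/-- **(S5) Existence of the family** for an explicit class system `ω`: for every level `Δ` choose the `ω Δ`-normalised Hodge–Riemann
form of `BettiUniverse.exists_hrFormOne`. [cite: VoisinHodgeI2002, §6.3.2 Thm. 6.32 (k = 1); §7.1.1] -/
theorem exists_hrFormFamily_ofSystem
    (hHD : exists_isReal_hodgeModel) (hI : hodgePQ_independent_of_hodgeModel) (hU : BallQuotientUniformisedDatum)
    (h₃ : CMAbelianVarietyRealised) {L : CMField} {ι₁ : L →+* ℂ} {V : HermSpace3 L ι₁}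
    (ω : ∀ Δ : Level V, bettiCohomology (Var.scheme hU h₃ (.pms (pmsCode L ι₁ V Δ))) 2) :
    ∃ B : ∀ Δ : Level V, Coh hHD hI hU h₃ Δ 1 →ₗ⋆[ℂ] Coh hHD hI hU h₃ Δ 1 →ₗ[ℂ] ℂ,
      ∀ (Δ : Level V) (α₁ β₁ α₂ β₂ : Coh hHD hI hU h₃ Δ 1),
        α₁ ∈ (BettiUniverse.hodge hHD (Var.isSmoothProjective hU h₃ (.pms (pmsCode L ι₁ V Δ))) 1).F 1 →
        β₁ ∈ (BettiUniverse.hodge hHD (Var.isSmoothProjective hU h₃ (.pms (pmsCode L ι₁ V Δ))) 1).F 1 →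
        α₂ ∈ Literature.AlgebraicGeometry.Motives.HodgeStructure.complexConj
          ((BettiUniverse.hodge hHD (Var.isSmoothProjective hU h₃ (.pms (pmsCode L ι₁ V Δ))) 1).F 1) →
        β₂ ∈ Literature.AlgebraicGeometry.Motives.HodgeStructure.complexConj
          ((BettiUniverse.hodge hHD (Var.isSmoothProjective hU h₃ (.pms (pmsCode L ι₁ V Δ))) 1).F 1) →
        B Δ (α₁ + α₂) (β₁ + β₂) =
          Complex.I * (BettiUniverse.trC (Var.isSmoothProjective hU h₃ (.pms (pmsCode L ι₁ V Δ))) 4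
              (LinearMap.BilinMap.baseChange ℂ (BettiUniverse.cup (Var.scheme hU h₃ (.pms (pmsCode L ι₁ V Δ))) 2 2)
                (LinearMap.BilinMap.baseChange ℂ (BettiUniverse.cup (Var.scheme hU h₃ (.pms (pmsCode L ι₁ V Δ))) 1 1) β₁
                  (Literature.AlgebraicGeometry.Motives.HodgeStructure.conj α₁))
                ((1 : ℂ) ⊗ₜ[ℚ] ω Δ)) /
            BettiUniverse.trC (Var.isSmoothProjective hU h₃ (.pms (pmsCode L ι₁ V Δ))) 4
              (LinearMap.BilinMap.baseChange ℂ (BettiUniverse.cup (Var.scheme hU h₃ (.pms (pmsCode L ι₁ V Δ))) 2 2)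
                ((1 : ℂ) ⊗ₜ[ℚ] ω Δ)
                ((1 : ℂ) ⊗ₜ[ℚ] ω Δ))) -
          Complex.I * (BettiUniverse.trC (Var.isSmoothProjective hU h₃ (.pms (pmsCode L ι₁ V Δ))) 4
              (LinearMap.BilinMap.baseChange ℂ (BettiUniverse.cup (Var.scheme hU h₃ (.pms (pmsCode L ι₁ V Δ))) 2 2)
                (LinearMap.BilinMap.baseChange ℂ (BettiUniverse.cup (Var.scheme hU h₃ (.pms (pmsCode L ι₁ V Δ))) 1 1) β₂
                  (Literature.AlgebraicGeometry.Motives.HodgeStructure.conj α₂))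
                ((1 : ℂ) ⊗ₜ[ℚ] ω Δ)) /
            BettiUniverse.trC (Var.isSmoothProjective hU h₃ (.pms (pmsCode L ι₁ V Δ))) 4
              (LinearMap.BilinMap.baseChange ℂ (BettiUniverse.cup (Var.scheme hU h₃ (.pms (pmsCode L ι₁ V Δ))) 2 2)
                ((1 : ℂ) ⊗ₜ[ℚ] ω Δ)
                ((1 : ℂ) ⊗ₜ[ℚ] ω Δ))) :=
  ⟨fun Δ => (BettiUniverse.exists_hrFormOne hHD (Var.isSmoothProjective hU h₃ (.pms (pmsCode L ι₁ V Δ)))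
      (ω Δ)).choose,
    fun Δ => (BettiUniverse.exists_hrFormOne hHD (Var.isSmoothProjective hU h₃ (.pms (pmsCode L ι₁ V Δ)))
      (ω Δ)).choose_spec⟩

/-! ## MAIN, explicit-system form -/

/-- **MAIN, explicit-system form — the tower representation is unitarizable.**  For `[L:ℚ] ≠ 2` (finite class sets, cocompact levels) and an
EXPLICIT family `ω Δ ∈ H²(X_Δ(ℂ); ℚ)` of Kähler classes (`hK`) on the levels `X_Δ` of `(L, ι₁, V)` that is EXACTLY compatible with the rational
translates (`hΩ2 : t_γ^* ω_{Δ₂} = ω_{Δ₁}`), the tower `H = colim_K H¹(X_K(ℂ); ℂ)` — as the representation `Representation.ofModule'` of the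
`ℂ[U(V)(𝔸_f)]`-module `Tower … V`, which IS `towerRep` (`ofModule'_tower_eq_towerRep`) and is the field `rhoB τ'` of the `h413` datum — carries a
`U(V)(𝔸_{L₀,f})`-invariant positive-definite Hermitian form: the colimit (p599036 `exists_invariantForm_towerRep`) of the weighted level forms
`B_Γ = Σ_q w_Γ(q) · HR_{X_{Γ_q}, ω}` of the `ω`-normalised Hodge–Riemann forms (`exists_hrFormFamily_ofSystem`; isometric under the translates by (S0)), `w_Γ = classWeight U(V)(L₀) K_f(3) K_Γ`.
This is `isUnitarizable_ofModule'_tower` (A-p10 p605005) with the named fact `BallQuotientKaehlerClassSystem` REPLACED by the per-tower triple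
`(ω, hK, hΩ2)` it actually consumes — the shape the B3-25 Model-side gluing `exists_towerKaehlerClassSystem` (from `L_FS`) supplies; the anisotropy
binder of the original only fed (Ω2)/(K) and is not needed once `hK`/`hΩ2` are given.  Proof verbatim otherwise.
[cite: Liu2021, Prop. 4.13 proof l. 2121–2131] [cite: VoisinHodgeI2002, §6.3.2 Thm. 6.32] [cite: ShimuraIATAF1971, §3.3 Prop. 3.6] -/
theorem isUnitarizable_ofModule'_tower_ofSystem
    (hHD : exists_isReal_hodgeModel) (hI : hodgePQ_independent_of_hodgeModel) (hU : BallQuotientUniformisedDatum)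
    (h₃ : CMAbelianVarietyRealised) (hA : Arapura2012_Cor_15_4_6) {L : CMField} {ι₁ : L →+* ℂ} (V : HermSpace3 L ι₁)
    (hL : Module.finrank ℚ L ≠ 2) (ω : ∀ Δ : Level V, bettiCohomology (Var.scheme hU h₃ (.pms (pmsCode L ι₁ V Δ))) 2)
    (hK : ∀ Δ : Level V, IsKaehlerClass 2 (Var.scheme hU h₃ (.pms (pmsCode L ι₁ V Δ)))
      (ofRatClass (ComplexPoints (Var.scheme hU h₃ (.pms (pmsCode L ι₁ V Δ)))) 2 (ω Δ)))
    (hΩ2 : ∀ {γ : GL (Fin 3) L} (hγ : γ ∈ Urat V) {Δ₁ Δ₂ : Level V} (ht : TransCond γ Δ₁ Δ₂),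
      BettiUniverse.pull (transMor hU h₃ hHD hA hγ Δ₁ Δ₂ ht) 2 (ω Δ₂) = ω Δ₁) :
    Representation.IsUnitarizable (G := ↥V.adelicFin) (V := Tower hHD hI hU h₃ hA V)
      (Representation.ofModule' (k := ℂ) (G := ↥V.adelicFin) (Tower hHD hI hU h₃ hA V)) := by
  classical
  rw [ofModule'_tower_eq_towerRep]
  obtain ⟨B, hB⟩ := exists_hrFormFamily_ofSystem hHD hI hU h₃ (V := V) ω
  -- (S0): the rational translates are isometries of the `ω`-normalised forms
  have hS0 : ∀ (γ : ↥(Urat V)) {Δ₁ Δ₂ : Level V} (ht : TransCond (γ : GL (Fin 3) L) Δ₁ Δ₂) (α β : Coh hHD hI hU h₃ Δ₂ 1),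
      B Δ₁ (trPull hHD hI hU h₃ hA γ Δ₁ Δ₂ ht 1 α) (trPull hHD hI hU h₃ hA γ Δ₁ Δ₂ ht 1 β) = B Δ₂ α β :=
    fun γ _ _ ht α β => hrForm_trPull_ofSystem hHD hI hU h₃ hA ω B hB hK hΩ2 γ ht α β
  haveI : ∀ Δ : Level V, Fintype (DoubleCoset.Quotient (((ρ V).range : Subgroup V.adelicFin) : Set V.adelicFin) (Δ.K : Set V.adelicFin)) :=
    fun Δ => @Fintype.ofFinite _ (HermSpace3.finite_doubleCoset_range_ρ V hL Δ.K Δ.isOpen_K)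
  -- the level forms, with reference level `K_f(3)`
  have hform := fun (Γ : Level V) (hΓ : Γ.BelowConjThree) => exists_levelForm hHD hI hU h₃ hA V B (Level.three V) Γ hΓ
  choose BΓ hBΓ using hform
  -- (S1) once and for all
  have hS1 : ∀ {Γ : Level V} (hΓ : Γ.BelowConjThree) (c c' : towerLevel hHD hI hU h₃ hA Γ hΓ) {γ : ↥(Urat V)} {x x' : V.adelicFin},
      Rel Γ γ x x' → B (Γ.conj x hΓ) ((c : Π h, W hHD hI hU h₃ Γ hΓ h) x) ((c' : Π h, W hHD hI hU h₃ Γ hΓ h) x) =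
        B (Γ.conj x' hΓ) ((c : Π h, W hHD hI hU h₃ Γ hΓ h) x') ((c' : Π h, W hHD hI hU h₃ Γ hΓ h) x') :=
    fun hΓ c c' _ _ _ r => hrForm_apply_eq_of_rel_ofIsometry hHD hI hU h₃ hA B hS0 hΓ c c' r
  obtain ⟨Binf, -, hs, hp, hinv⟩ := Summit.HodgeConjecture.CorCM.Lines.A3Liu413.exists_invariantForm_towerRep hHD hI hU h₃ hA BΓ
    (fun hle hΓ hΓ' c c' => by
      rw [hBΓ, hBΓ]
      exact levelSum_restrict hHD hI hU h₃ hA V B hL (Level.three V) hS1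
        (fun hle hΓ hΓ' c c' x => hrForm_restrictLevel_apply_ofIsometry hHD hI hU h₃ hA B hS0 hle hΓ hΓ' c c' x) hle hΓ hΓ' c c')
    (fun Γ hΓ c c' => by
      rw [hBΓ, hBΓ]
      exact levelSum_symm hHD hI hU h₃ hA V B (Level.three V)
        (fun Δ α β => BettiUniverse.hrFormOne_symm (Var.isSmoothProjective hU h₃ (.pms (pmsCode L ι₁ V Δ))) (ω Δ) (hB Δ) α β) hΓ c c')
    (fun Γ hΓ c hc => by
      rw [hBΓ]
      exact levelSum_pos hHD hI hU h₃ hA V B (Level.three V)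
        (fun Δ α hα => BettiUniverse.hrFormOne_posDef (Var.isSmoothProjective hU h₃ (.pms (pmsCode L ι₁ V Δ))) (ω Δ) (hB Δ) (hK Δ) α hα)
        hΓ c hc)
    (fun Γ hΓ g c c' => by
      rw [hBΓ, hBΓ]
      exact levelSum_translate hHD hI hU h₃ hA V B hL (Level.three V) hS1
        (fun hΓ g c c' x => hrForm_translate_apply_ofIsometry hHD hI hU h₃ hA B hS0 hΓ g c c' x) hΓ g c c')
  exact ⟨Binf, LinearMap.isSymm_def.mpr (fun v w => by rw [hs v w]; exact Complex.conj_conj _), hp, hinv⟩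

end Model.TowerLevel

end HodgeCM

end
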